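import Summits.Ventures.PercRepro.Night2DQm1Mass

/-!
# PercRepro — the regime `|E ∖ G| = q − 1`: the cell theorem modulo its target sum, and the sum in closed form (night-2, gen 19)

**`localShadowHall_dqm1_of_sum`**: for a simple loopless matroid `M`, a rank-`(q+1)` flat `G` with `|E ∖ G| = q − 1`
and `kColoops (M|G) + ρ = q + 1` (`ρ ≥ 3`), the local form (LI_G) holds as soon as the target sum

  `dqm1Sum n q ρ k = Σ_{j=1}^{n−ρ} C(n−ρ, j) · c_j / (ρ λ C(j+ρ, ρ))`,   `c_j = c′` for `j + ρ + 2 ≤ n`, `1` else,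

is at least `1` for every `n ≥ ρ + 2` (`n = |G ∖ K|`, `λ = lambdaDQ`, `c′ = cPrimeDQ`).  The certificate is the
fair-share loss routing (`localShadowHall_of_lossFair`): a loss sits only at a hyperplane-basis member `B = K ∪ T`,
`|T| = ρ − 1` (`loss_eq_zero_of_card_ge_dqm1`), its targets are the `2^{n−ρ} − 1` sets `B ∪ {z} ∪ X` (`card_tgtSets`),
each carrying loss mass at most `ρ C(|S ∖ K|, ρ) λ/(2^{n−ρ} − 1)` (`pi2Mass_le_dqm1`) and residual capacity at least
`c′` (or `1` when `|G ∖ S| ≤ 1`; `cap2_ge_cPrimeDQ`, `cap2_eq_one_of_card_sdiff_le_one`); the size-bound lemma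
`lossIncome_ge_of_bounds` turns the per-loss inequality into `dqm1Sum ≥ 1`.  The rigid cell is `ρ = 3`; the `(7, 5)`
cells `(4, 2)` and `(4, 1)` are `ρ = 4, 5` at `q = 5` (`Night2FourTwoCell`, `Night2FourOneCell`).

## The target sum in closed form


`dqm1Sum n q ρ k = Σ_{j=1}^{n−ρ} C(n−ρ, j) · c_j / (ρ λ C(j+ρ, ρ))` with `c_j = c′` for `j + ρ + 2 ≤ n` and `1` at
the top two levels.  The binomial identity `C(n−ρ, j) / C(j+ρ, ρ) = C(n, j+ρ) / C(n, ρ)` (`choose_div_eq_dqm1`, from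
`Nat.choose_mul`) and the split of the sum at the top two levels give

  **`dqm1Sum_eq`**: `dqm1Sum n q ρ k = (c′ · A_ρ(n) + (n + 1)) / (ρ λ C(n, ρ))`,   `A_ρ(n) = Σ_{i=ρ+1}^{n−2} C(n, i)`,

so a cell is closed by one explicit inequality `ρ λ C(n, ρ) ≤ c′ A_ρ(n) + n + 1` for every `n ≥ ρ + 2`
(`Night2FourTwoIneq`, `Night2FourOneIneq` at `q = 5`).  `Aρ_ge_two`: `A_ρ(n) ≥ C(n, ρ+1) + C(n, ρ+2)` for `n ≥ ρ + 4`
is the growth bound used for the large `n`.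
-/

namespace PercRepro.Shadow

open Finset PerFlat ThmH

namespace DQm1

/-- The coefficient of the targets of size `ρ + j` off the coloops: `c′` in the middle, `1` at the top two levels. -/
noncomputable def cjDQ (n q ρ k j : ℕ) : ℚ := if j + ρ + 2 ≤ n then cPrimeDQ q ρ k else 1

/-- The target sum of the regime `|E ∖ G| = q − 1`. -/
noncomputable def dqm1Sum (n q ρ k : ℕ) : ℚ :=
  ∑ j ∈ Finset.Icc 1 (n - ρ),
    ((n - ρ).choose j : ℚ) * (cjDQ n q ρ k j / ((ρ : ℚ) * lambdaDQ q ρ k * ((j + ρ).choose ρ : ℚ)))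

end DQm1

variable {α : Type*} [DecidableEq α] {M : Matroid α} [M.Finite]

open scoped Classical in
/-- A hyperplane-basis member (`|B ∖ K| + 1 = ρ`) forces `n = |G ∖ K| ≥ ρ + 2` (`|E ∖ G| = q − 1`). -/
theorem add_two_le_of_thin_basis {q ρ : ℕ} {G : Finset α} (hG : G ∈ flatsQ M (q + 1))
    (hd : (gr M \ G).card = q - 1) {B : Finset α} (hB : B ∈ thinMembers M q G)
    (hcard : (B \ coloops M G).card + 1 = ρ) : ρ + 2 ≤ G.card - kColoops M G := by
  have hd' : (gr M \ G).card ≤ q := by omega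
  have hB' : B ∈ membersIn M (Uq M (q + 2) q) G := (mem_thinMembers.1 hB).1
  have hBU : B ∈ Uq M (q + 2) q := (mem_membersIn.1 hB').1
  have hBG : B ⊆ G := (subset_clF hBU).trans (mem_membersIn.1 hB').2
  have hK := coloops_subset_of_mem_thinMembers hG hd' hB
  have hGg : G ⊆ gr M := (mem_flatsQ.1 hG).1
  have hq1 : 1 ≤ q := le_trans (one_le_card_compl_of_member hG hBU) hd'
  -- ρ(E ∖ B) = q + 2 ≤ ρ(E ∖ G) + ρ(G ∖ B) ≤ (q − 1) + |G ∖ B|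
  have hr : M.eRk ((gr M \ B : Finset α) : Set α) = ((q + 2 : ℕ) : ℕ∞) := (mem_Uq.1 hBU).2.2
  have hsplit : gr M \ B = (gr M \ G) ∪ (G \ B) := by
    ext x; simp only [Finset.mem_sdiff, Finset.mem_union]
    constructor
    · rintro ⟨hx, hxB⟩; by_cases hxG : x ∈ G
      · exact Or.inr ⟨hxG, hxB⟩
      · exact Or.inl ⟨hx, hxG⟩
    · rintro (⟨hx, hxG⟩ | ⟨hxG, hxB⟩)
      · exact ⟨hx, fun h => hxG (hBG h)⟩
      · exact ⟨hGg hxG, hxB⟩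
  have hsub : M.eRk ((gr M \ B : Finset α) : Set α) ≤
      M.eRk ((gr M \ G : Finset α) : Set α) + M.eRk ((G \ B : Finset α) : Set α) := by
    rw [hsplit, Finset.coe_union]
    exact M.eRk_union_le_eRk_add_eRk _ _
  have h1 : M.eRk ((gr M \ G : Finset α) : Set α) ≤ ((q - 1 : ℕ) : ℕ∞) := by
    calc M.eRk ((gr M \ G : Finset α) : Set α) ≤ ((gr M \ G : Finset α) : Set α).encard := M.eRk_le_encard _
      _ = ((q - 1 : ℕ) : ℕ∞) := by rw [Set.encard_coe_eq_coe_finsetCard, hd]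
  have h2' : M.eRk ((G \ B : Finset α) : Set α) ≤ ((G \ B).card : ℕ∞) := by
    calc M.eRk ((G \ B : Finset α) : Set α) ≤ ((G \ B : Finset α) : Set α).encard := M.eRk_le_encard _
      _ = ((G \ B).card : ℕ∞) := by rw [Set.encard_coe_eq_coe_finsetCard]
  rw [hr] at hsub
  have h3 : ((q + 2 : ℕ) : ℕ∞) ≤ ((q - 1 : ℕ) : ℕ∞) + ((G \ B).card : ℕ∞) := hsub.trans (add_le_add h1 h2')
  have h4 : q + 2 ≤ (q - 1) + (G \ B).card := by exact_mod_cast h3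
  have hBcard : B.card = kColoops M G + (B \ coloops M G).card := by
    rw [kColoops_eq_card_coloops, ← Finset.card_union_of_disjoint Finset.disjoint_sdiff,
      Finset.union_sdiff_of_subset hK]
  have hGB : (G \ B).card = G.card - B.card := Finset.card_sdiff_of_subset hBG
  have hKG : (coloops M G).card ≤ G.card := Finset.card_le_card (hK.trans hBG)
  have hBG' : B.card ≤ G.card := Finset.card_le_card hBG
  rw [kColoops_eq_card_coloops] at hBcard ⊢
  omega

open scoped Classical in
/-- **THE CELL THEOREM OF THE REGIME `|E ∖ G| = q − 1` MODULO ITS TARGET SUM**: for a simple loopless matroid, a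
rank-`(q+1)` flat `G` with `|E ∖ G| = q − 1` and `kColoops (M|G) + ρ = q + 1`, `ρ ≥ 3`, the local form (LI_G) holds
as soon as `dqm1Sum n q ρ kColoops ≥ 1` for every `n ≥ ρ + 2`. -/
theorem localShadowHall_dqm1_of_sum {q ρ : ℕ} {G : Finset α} (hG : G ∈ flatsQ M (q + 1))
    (hd : (gr M \ G).card = q - 1) (hk : kColoops M G + ρ = q + 1) (hρ : 3 ≤ ρ)
    (hs : ∀ e ∈ gr M, ∀ f ∈ gr M, e ≠ f → rkN M {e, f} = 2) (hl : ∀ e ∈ gr M, M.Indep {e})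
    (hsum : ∀ n : ℕ, ρ + 2 ≤ n → 1 ≤ DQm1.dqm1Sum n q ρ (kColoops M G)) : LocalShadowHall M q G := by
  have hd' : (gr M \ G).card ≤ q := by omega
  apply localShadowHall_of_lossFair hG hd'
  intro B hB z hz
  by_cases hl0 : loss M q G B z = 0
  · rw [hl0]
    exact mul_nonneg (rhoL_nonneg hG hd' B z) (lossIncome_nonneg hG hd' B z)
  -- a lossy hyperplane-basis member
  have hB' : B ∈ membersIn M (Uq M (q + 2) q) G := (mem_thinMembers.1 hB).1
  have hBU : B ∈ Uq M (q + 2) q := (mem_membersIn.1 hB').1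
  have hzB : z ∉ B := notMem_of_notMem_clF hBU (Finset.mem_sdiff.1 hz).2
  have hK := coloops_subset_of_mem_thinMembers hG hd' hB
  have hq1 : 1 ≤ q := le_trans (one_le_card_compl_of_member hG hBU) hd'
  have h2 : (B \ coloops M G).card + 1 = ρ := by
    by_contra hne
    have hge := card_sdiff_coloops_thin_ge hG hd' hk hB
    exact hl0 (loss_eq_zero_of_card_ge_dqm1 hG hd hk (by omega) hs hl hB (by omega) hz)
  have hn2 : ρ + 2 ≤ G.card - kColoops M G := add_two_le_of_thin_basis hG hd hB h2
  set n := G.card - kColoops M G with hn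
  have hr : (G \ insert z B).card = n - ρ := card_sdiff_insert_eq_dqm1 hG hd' hB h2 hz
  have hBcard : B.card = kColoops M G + (B \ coloops M G).card := by
    rw [kColoops_eq_card_coloops, ← Finset.card_union_of_disjoint Finset.disjoint_sdiff,
      Finset.union_sdiff_of_subset hK]
  have hb : (insert z B).card = q + 1 := by rw [Finset.card_insert_of_notMem hzB, hBcard]; omega
  have hT : (tgtSets M q G B z).card = 2 ^ (n - ρ) - 1 := by rw [card_tgtSets hG hB' hz, hr]
  have hTpos : (0 : ℚ) < ((2 ^ (n - ρ) - 1 : ℕ) : ℚ) := by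
    have : 2 ≤ 2 ^ (n - ρ) := by
      calc 2 = 2 ^ 1 := by norm_num
        _ ≤ 2 ^ (n - ρ) := Nat.pow_le_pow_right (by norm_num) (by omega)
    exact_mod_cast (by omega : 0 < 2 ^ (n - ρ) - 1)
  have hlam : 0 < lambdaDQ q ρ (kColoops M G) := lambdaDQ_pos hk hq1 (by omega)
  have hc' : 0 < cPrimeDQ q ρ (kColoops M G) := cPrimeDQ_pos hk hq1 (by omega)
  -- the size bounds on the targets
  set u : ℕ → ℚ := fun s => ((ρ : ℚ) * ((s - kColoops M G).choose ρ : ℚ)) *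
    (lambdaDQ q ρ (kColoops M G) / ((2 ^ (n - ρ) - 1 : ℕ) : ℚ)) with hu_def
  set v : ℕ → ℚ := fun s => if s ≤ G.card - 2 then cPrimeDQ q ρ (kColoops M G) else 1 with hv_def
  have hKS : ∀ S ∈ tgtSets M q G B z, coloops M G ⊆ S :=
    fun S hS => coloops_subset_of_mem_shadowAt (mem_tgtSets.1 hS).1
  have hSK : ∀ S ∈ tgtSets M q G B z, (S \ coloops M G).card = S.card - kColoops M G := by
    intro S hS
    rw [Finset.card_sdiff_of_subset (hKS S hS), kColoops_eq_card_coloops]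
  have hρ1 : ∀ S ∈ tgtSets M q G B z, ρ + 1 ≤ (S \ coloops M G).card := by
    intro S hS
    obtain ⟨-, hBS, hcard⟩ := mem_tgtSets.1 hS
    have hBS' : B ⊆ S := (Finset.subset_insert z B).trans hBS
    have hsub : (S \ B) ∪ (B \ coloops M G) ⊆ S \ coloops M G := by
      intro x hx
      rw [Finset.mem_union, Finset.mem_sdiff, Finset.mem_sdiff] at hx
      rw [Finset.mem_sdiff]
      rcases hx with ⟨hxS, hxB⟩ | ⟨hxB, hxK⟩
      · exact ⟨hxS, fun h => hxB (hK h)⟩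
      · exact ⟨hBS' hxB, hxK⟩
    have hdisj : Disjoint (S \ B) (B \ coloops M G) := by
      rw [Finset.disjoint_left]; intro x hx hx'
      exact (Finset.mem_sdiff.1 hx).2 (Finset.mem_sdiff.1 hx').1
    have := Finset.card_le_card hsub
    rw [Finset.card_union_of_disjoint hdisj] at this
    omega
  have hu : ∀ S ∈ tgtSets M q G B z, pi2Mass M q G S ≤ u S.card := by
    intro S hS
    have := pi2Mass_le_dqm1 hG hd hk (by omega) hs hl (mem_tgtSets.1 hS).1
    rw [hSK S hS] at this
    simpa [hu_def, hn] using this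
  have hv : ∀ S ∈ tgtSets M q G B z, v S.card ≤ cap2 M q G S := by
    intro S hS
    have hS' := (mem_tgtSets.1 hS).1
    have hSG : S ⊆ G := subset_G_of_mem_shadowAt hS'
    simp only [hv_def]
    split_ifs with hle
    · exact cap2_ge_cPrimeDQ hG hd hk hs hl hS' (hρ1 S hS)
    · push Not at hle
      have h1 : (G \ S).card ≤ 1 := by
        rw [Finset.card_sdiff_of_subset hSG]; omega
      exact (cap2_eq_one_of_card_sdiff_le_one hG hd hq1 h1).ge
  have hv0 : ∀ S ∈ tgtSets M q G B z, 0 ≤ v S.card := by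
    intro S _
    simp only [hv_def]
    split_ifs
    · exact hc'.le
    · exact zero_le_one
  have hinc := lossIncome_ge_of_bounds hG hd' hB hz hl0 u v hu hv hv0
  rw [hr, hb] at hinc
  -- the explicit sum is (2^{n−ρ} − 1) · dqm1Sum
  have hsum' : ∑ j ∈ Finset.Icc 1 (n - ρ), ((n - ρ).choose j : ℚ) * (v (q + 1 + j) / u (q + 1 + j)) =
      ((2 ^ (n - ρ) - 1 : ℕ) : ℚ) * DQm1.dqm1Sum n q ρ (kColoops M G) := by
    unfold DQm1.dqm1Sum
    rw [Finset.mul_sum]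
    apply Finset.sum_congr rfl
    intro j hj
    rw [Finset.mem_Icc] at hj
    have hv' : v (q + 1 + j) = DQm1.cjDQ n q ρ (kColoops M G) j := by
      simp only [hv_def, DQm1.cjDQ]
      have hiff : q + 1 + j ≤ G.card - 2 ↔ j + ρ + 2 ≤ n := by omega
      by_cases hc : j + ρ + 2 ≤ n
      · rw [if_pos (hiff.2 hc), if_pos hc]
      · rw [if_neg (fun h => hc (hiff.1 h)), if_neg hc]
    have hu' : u (q + 1 + j) = ((ρ : ℚ) * ((j + ρ).choose ρ : ℚ)) *
        (lambdaDQ q ρ (kColoops M G) / ((2 ^ (n - ρ) - 1 : ℕ) : ℚ)) := by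
      simp only [hu_def]
      rw [show q + 1 + j - kColoops M G = j + ρ by omega]
    rw [hv', hu']
    have hjρ : (0 : ℚ) < ((j + ρ).choose ρ : ℚ) := by exact_mod_cast Nat.choose_pos (by omega)
    have hρ0 : (0 : ℚ) < (ρ : ℚ) := by exact_mod_cast (by omega : 0 < ρ)
    field_simp
  rw [hsum'] at hinc
  -- conclude: loss ≤ (loss/|Tgt|) · lossIncome
  have hone := hsum n hn2
  unfold rhoL
  rw [hT]
  have hl' : 0 < loss M q G B z := lt_of_le_of_ne (loss_nonneg' hG hd' B z) (Ne.symm hl0)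
  calc loss M q G B z = loss M q G B z / ((2 ^ (n - ρ) - 1 : ℕ) : ℚ) * ((2 ^ (n - ρ) - 1 : ℕ) : ℚ) := by
        field_simp
    _ ≤ loss M q G B z / ((2 ^ (n - ρ) - 1 : ℕ) : ℚ) *
          (((2 ^ (n - ρ) - 1 : ℕ) : ℚ) * DQm1.dqm1Sum n q ρ (kColoops M G)) := by
        apply mul_le_mul_of_nonneg_left _ (div_nonneg hl'.le hTpos.le)
        nlinarith [hone, hTpos]
    _ ≤ loss M q G B z / ((2 ^ (n - ρ) - 1 : ℕ) : ℚ) * lossIncome M q G B z :=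
        mul_le_mul_of_nonneg_left hinc (div_nonneg hl'.le hTpos.le)


/-! ## The target sum in closed form -/

namespace DQm1

/-- `A_ρ(n) = Σ_{i=ρ+1}^{n−2} C(n, i)` (a natural number). -/
def Aρ (n ρ : ℕ) : ℕ := ∑ i ∈ Finset.Ico (ρ + 1) (n - 1), n.choose i

/-- `C(n−ρ, j) / C(j+ρ, ρ) = C(n, j+ρ) / C(n, ρ)` for `ρ ≤ n`. -/
theorem choose_div_eq_dqm1 {n ρ j : ℕ} (hρn : ρ ≤ n) :
    ((n - ρ).choose j : ℚ) / ((j + ρ).choose ρ : ℚ) = (n.choose (j + ρ) : ℚ) / (n.choose ρ : ℚ) := by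
  have h := Nat.choose_mul (n := n) (k := j + ρ) (s := ρ) (by omega)
  rw [show j + ρ - ρ = j by omega] at h
  have h1 : (0 : ℚ) < ((j + ρ).choose ρ : ℚ) := by exact_mod_cast Nat.choose_pos (by omega)
  have h2 : (0 : ℚ) < (n.choose ρ : ℚ) := by exact_mod_cast Nat.choose_pos hρn
  rw [div_eq_div_iff h1.ne' h2.ne']
  have h' : (n - ρ).choose j * n.choose ρ = n.choose (j + ρ) * (j + ρ).choose ρ := by
    rw [mul_comm]; exact h.symm
  exact_mod_cast h'

/-- `A_ρ(n)` as a rational sum. -/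
theorem cast_Aρ (n ρ : ℕ) : (Aρ n ρ : ℚ) = ∑ i ∈ Finset.Ico (ρ + 1) (n - 1), (n.choose i : ℚ) := by
  unfold Aρ; push_cast; rfl

/-- **The target sum in closed form**: `dqm1Sum = (c′ A_ρ(n) + (n+1)) / (ρ λ C(n, ρ))` for `n ≥ ρ + 2`, `ρ ≥ 1`,
`λ > 0`. -/
theorem dqm1Sum_eq {n q ρ k : ℕ} (hn : ρ + 2 ≤ n) (hρ : 1 ≤ ρ) (hlam : 0 < lambdaDQ q ρ k) :
    dqm1Sum n q ρ k =
      (cPrimeDQ q ρ k * (Aρ n ρ : ℚ) + ((n : ℚ) + 1)) / ((ρ : ℚ) * lambdaDQ q ρ k * (n.choose ρ : ℚ)) := by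
  have hρ0 : (0 : ℚ) < (ρ : ℚ) := by exact_mod_cast hρ
  have hC : (0 : ℚ) < (n.choose ρ : ℚ) := by exact_mod_cast Nat.choose_pos (by omega)
  unfold dqm1Sum
  -- rewrite every term through the binomial identity
  have hterm : ∀ j ∈ Finset.Icc 1 (n - ρ),
      ((n - ρ).choose j : ℚ) * (cjDQ n q ρ k j / ((ρ : ℚ) * lambdaDQ q ρ k * ((j + ρ).choose ρ : ℚ))) =
      (1 / ((ρ : ℚ) * lambdaDQ q ρ k * (n.choose ρ : ℚ))) * (cjDQ n q ρ k j * (n.choose (j + ρ) : ℚ)) := by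
    intro j _
    have h := choose_div_eq_dqm1 (n := n) (ρ := ρ) (j := j) (by omega)
    have hj : (0 : ℚ) < ((j + ρ).choose ρ : ℚ) := by exact_mod_cast Nat.choose_pos (by omega)
    rw [show ((n - ρ).choose j : ℚ) * (cjDQ n q ρ k j / ((ρ : ℚ) * lambdaDQ q ρ k * ((j + ρ).choose ρ : ℚ))) =
        (cjDQ n q ρ k j / ((ρ : ℚ) * lambdaDQ q ρ k)) * (((n - ρ).choose j : ℚ) / ((j + ρ).choose ρ : ℚ)) by
          field_simp, h]
    field_simp
  rw [Finset.sum_congr rfl hterm, ← Finset.mul_sum]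
  -- split the sum at the top two levels
  have hsplit : ∑ j ∈ Finset.Icc 1 (n - ρ), cjDQ n q ρ k j * (n.choose (j + ρ) : ℚ) =
      cPrimeDQ q ρ k * (Aρ n ρ : ℚ) + ((n : ℚ) + 1) := by
    have hIcc : Finset.Icc 1 (n - ρ) = Finset.Ico 1 (n - ρ + 1) := by
      ext j; simp only [Finset.mem_Icc, Finset.mem_Ico]; omega
    rw [hIcc, ← Finset.sum_Ico_consecutive _ (by omega : 1 ≤ n - ρ - 1) (by omega : n - ρ - 1 ≤ n - ρ + 1)]
    have hA : ∑ j ∈ Finset.Ico 1 (n - ρ - 1), cjDQ n q ρ k j * (n.choose (j + ρ) : ℚ) =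
        cPrimeDQ q ρ k * (Aρ n ρ : ℚ) := by
      rw [cast_Aρ, Finset.mul_sum, Finset.sum_Ico_eq_sum_range, Finset.sum_Ico_eq_sum_range]
      rw [show n - 1 - (ρ + 1) = n - ρ - 1 - 1 by omega]
      apply Finset.sum_congr rfl
      intro m hm
      rw [Finset.mem_range] at hm
      unfold cjDQ
      rw [if_pos (by omega), show ρ + 1 + m = 1 + m + ρ by ring]
    have hB : ∑ j ∈ Finset.Ico (n - ρ - 1) (n - ρ + 1), cjDQ n q ρ k j * (n.choose (j + ρ) : ℚ) =
        (n : ℚ) + 1 := by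
      have e : Finset.Ico (n - ρ - 1) (n - ρ + 1) = {n - ρ - 1, n - ρ} := by
        ext j; simp only [Finset.mem_Ico, Finset.mem_insert, Finset.mem_singleton]; omega
      rw [e, Finset.sum_pair (by omega)]
      unfold cjDQ
      rw [if_neg (by omega), if_neg (by omega), show n - ρ - 1 + ρ = n - 1 by omega,
        show n - ρ + ρ = n by omega, Nat.choose_self]
      have : n.choose (n - 1) = n := by
        rw [Nat.choose_symm (by omega : 1 ≤ n), Nat.choose_one_right]
      rw [this]; push_cast; ring
    rw [hA, hB]
  rw [hsplit]
  field_simp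

/-- `A_ρ(n) ≥ C(n, ρ+1) + C(n, ρ+2)` for `n ≥ ρ + 4`. -/
theorem Aρ_ge_two {n ρ : ℕ} (hn : ρ + 4 ≤ n) : n.choose (ρ + 1) + n.choose (ρ + 2) ≤ Aρ n ρ := by
  unfold Aρ
  have hsub : Finset.Ico (ρ + 1) (ρ + 3) ⊆ Finset.Ico (ρ + 1) (n - 1) := by
    intro i hi; rw [Finset.mem_Ico] at hi ⊢; omega
  have h := Finset.sum_le_sum_of_subset (f := fun i => n.choose i) hsub
  rw [Finset.sum_Ico_succ_top (by omega), Finset.sum_Ico_succ_top (by omega), Finset.Ico_self,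
    Finset.sum_empty, zero_add] at h
  exact h

end DQm1


end PercRepro.Shadow
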